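import Summits.AtomisticToContinuum.Crystallization.Theorems.ExcessDecayLiouvilleSiteGeometry
import Summits.AtomisticToContinuum.Crystallization.Theorems.ExcessDecayLiouvilleHcpLiouvilleDefs

/-!
# `ExcessDecayLiouville.HcpLiouville` (stmt-AtomisticToContinuum-9332), line `Sketch`: flat period differences force a two-lattice

Stub `stub_sites_of_flat` of the line `two-level-caccioppoli` (crux `HcpLiouville`, lead skeleton
`Lines/Sketch.lean`): the last, purely combinatorial step.  If `u` is a displacement of the reference sites
`S = Sites₀ t A` onto `X` (`IsDisplacement X t A u`: `‖u s‖ ≤ 1/40` on `S` and `s ↦ s + u s` a bijection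
`S → X`) whose period differences `u(· + Az) − u` (`z ∈ Λ₀`) take equal values at the ends of every
nearest-neighbour (`≤ 11/10`) bond of `S` (`NNFlat t A u`), then `X` is the two-lattice `Sites₀ t' A` with
`t' m = t m + u (t m)` (same cell `A`).

Proof.  For each generator `e ∈ {u, v, c}` of `Λ₀ = ℤu + ℤv + ℤc` (`c = 2√(2/3)e₃`) the period difference
`w(p) = u(p + Ae) − u(p)` is invariant under `p ↦ p + Ae` on `S`: for `e = u, v` the bond `p ∼ p + Ae` has
length `‖Ae‖ ≤ 199/200` (`Adm₀`, `‖u‖ = ‖v‖ = 1`); for `e = c` one passes through the other sublattice along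
the two bonds `t 0 + Aζ ∼ t 1 + Aζ ∼ t 0 + A(ζ + c)`, of length `≤ 199/200 + 1/40` (`Inner₀` and
`‖w₀ + √(2/3)e₃‖ = ‖c − w₀ − √(2/3)e₃‖ = 1` for the hcp motif vector).  Hence `u(p + nAe) = u(p) + n·w(p)`
along the ray, and `‖u‖ ≤ 1/40` on `S` forces `w(p) = 0` (Archimedes).  The periods
`{z ∈ Λ₀ | u(· + Az) = u on S}` thus form a subgroup containing `u, v, c`, i.e. all of `Λ₀`; finally
`X = (s ↦ s + u s) '' S = Sites₀ t' A` by `Set.BijOn.image_eq`.  All `[folklore]`; a `--supports` helper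
for item stmt-AtomisticToContinuum-9332, nothing here closes an item.
-/

noncomputable section

namespace Summit.AtomisticToContinuum.Crystallization.Theorems.ExcessDecayLiouville

open scoped BigOperators Topology Classical InnerProductSpace
open Literature.MathematicalPhysics.StatisticalMechanics
open Summit.AtomisticToContinuum.Crystallization.Theses.ExcessDecayLiouville
open Summit.AtomisticToContinuum.Crystallization.Theorems.PhononStabilityNegative

local notation "E3" => EuclideanSpace ℝ (Fin 3)

/-! ## The generators of `Λ₀` and the hcp motif vector -/

/-- `v = triangularVec₂ 1 ∈ Λ₀`. [folklore] -/
private theorem triangularVec₂_mem_Λ₀ : (triangularVec₂ 1 : E3) ∈ Λ₀ :=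
  ⟨0, 1, 0, by simp⟩

/-- The layer period `c = 2√(2/3)e₃` lies in `Λ₀`. [folklore] -/
private theorem layerPeriod_mem_Λ₀ : (layerNormal (2 * Real.sqrt (2 / 3)) : E3) ∈ Λ₀ :=
  ⟨0, 0, 1, by simp⟩

/-- `‖v‖ = 1` for `v = triangularVec₂ 1 = (1/2, √3/2, 0)`. [folklore] -/
private theorem norm_triangularVec₂_eq_one : ‖(triangularVec₂ 1 : E3)‖ = 1 := by
  have h : ‖(triangularVec₂ 1 : E3)‖ ^ 2 = 1 := by
    rw [EuclideanSpace.norm_eq, Real.sq_sqrt (by positivity), Fin.sum_univ_three]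
    simp [triangularVec₂, Real.norm_eq_abs, sq_abs, div_pow, Real.sq_sqrt (show (0:ℝ) ≤ 3 by norm_num)]
    norm_num
  nlinarith [norm_nonneg (triangularVec₂ 1 : E3)]

/-- The hcp motif vector `w₀ + √(2/3)e₃ = (1/2, √3/6, √(2/3))` is a unit vector. [folklore] -/
private theorem norm_motif_eq_one : ‖(barlowOffset 1 + layerNormal (Real.sqrt (2 / 3)) : E3)‖ = 1 := by
  have h : ‖(barlowOffset 1 + layerNormal (Real.sqrt (2 / 3)) : E3)‖ ^ 2 = 1 := by
    rw [EuclideanSpace.norm_eq, Real.sq_sqrt (by positivity), Fin.sum_univ_three]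
    simp [barlowOffset, layerNormal, Real.norm_eq_abs, sq_abs, div_pow,
      Real.sq_sqrt (show (0:ℝ) ≤ 3 by norm_num)]
    norm_num
  nlinarith [norm_nonneg (barlowOffset 1 + layerNormal (Real.sqrt (2 / 3)) : E3)]

/-- `c − (w₀ + √(2/3)e₃) = (−1/2, −√3/6, √(2/3))` is a unit vector. [folklore] -/
private theorem norm_layerPeriod_sub_motif_eq_one :
    ‖(layerNormal (2 * Real.sqrt (2 / 3)) - (barlowOffset 1 + layerNormal (Real.sqrt (2 / 3))) : E3)‖
      = 1 := by
  have h : ‖(layerNormal (2 * Real.sqrt (2 / 3)) -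
      (barlowOffset 1 + layerNormal (Real.sqrt (2 / 3))) : E3)‖ ^ 2 = 1 := by
    rw [EuclideanSpace.norm_eq, Real.sq_sqrt (by positivity), Fin.sum_univ_three]
    simp [barlowOffset, layerNormal, Real.norm_eq_abs, sq_abs, div_pow,
      Real.sq_sqrt (show (0:ℝ) ≤ 3 by norm_num)]
    have s23 : (Real.sqrt (2 / 3)) ^ 2 = 2 / 3 := Real.sq_sqrt (by norm_num)
    have hq : (Real.sqrt 2 / Real.sqrt 3 : ℝ) ^ 2 = 2 / 3 := by
      rw [div_pow, Real.sq_sqrt (by norm_num), Real.sq_sqrt (by norm_num)]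
    nlinarith [s23, hq]
  nlinarith [norm_nonneg
    (layerNormal (2 * Real.sqrt (2 / 3)) - (barlowOffset 1 + layerNormal (Real.sqrt (2 / 3))) : E3)]

/-! ## Site-set bookkeeping -/

/-- The site set is stable under the lattice translations `A Λ₀`. [folklore] -/
private theorem add_apply_mem_sites₀ {t : Fin 2 → E3} {A : E3 →L[ℝ] E3} {p e : E3}
    (hp : p ∈ Sites₀ t A) (he : e ∈ Λ₀) : p + A e ∈ Sites₀ t A := by
  obtain ⟨m, z, hz, rfl⟩ := hp
  exact ⟨m, z + e, hcpLiouvilleLam_add_mem hz he, by rw [map_add, add_assoc]⟩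

/-- The site set is stable under the lattice translations `−A Λ₀`. [folklore] -/
private theorem sub_apply_mem_sites₀ {t : Fin 2 → E3} {A : E3 →L[ℝ] E3} {p e : E3}
    (hp : p ∈ Sites₀ t A) (he : e ∈ Λ₀) : p - A e ∈ Sites₀ t A := by
  obtain ⟨m, z, hz, rfl⟩ := hp
  exact ⟨m, z - e, hcpLiouvilleLam_sub_mem hz he, by rw [map_sub, add_sub_assoc]⟩

/-- The two sublattice origins are sites. [folklore] -/
private theorem apply_mem_sites₀ (t : Fin 2 → E3) (A : E3 →L[ℝ] E3) (m : Fin 2) : t m ∈ Sites₀ t A :=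
  ⟨m, 0, zero_mem_Λ₀, by rw [map_zero, add_zero]⟩

/-! ## The two inter-sublattice bonds are nearest-neighbour bonds -/

/-- `‖t 1 − t 0‖ ≤ 199/200 + 1/40` for an admissible hcp-like datum. [folklore] -/
private theorem norm_inner_shift_le {t : Fin 2 → E3} {A : E3 →L[ℝ] E3} (hA : Adm₀ A) (hI : Inner₀ t A) :
    ‖t 1 - t 0‖ ≤ 199 / 200 + 1 / 40 := by
  have h1 : ‖A (barlowOffset 1 + layerNormal (Real.sqrt (2 / 3)))‖ ≤ 199 / 200 := by
    have := norm_apply_le_of_adm₀ hA (barlowOffset 1 + layerNormal (Real.sqrt (2 / 3)))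
    rwa [norm_motif_eq_one, mul_one] at this
  have h2 : ‖t 1 - t 0 - A (barlowOffset 1 + layerNormal (Real.sqrt (2 / 3)))‖ ≤ 1 / 40 := hI
  have h3 := norm_sub_norm_le (t 1 - t 0) (A (barlowOffset 1 + layerNormal (Real.sqrt (2 / 3))))
  linarith

/-- The bond `t 0 + Aζ ∼ t 1 + Aζ` has length `≤ 11/10`. [folklore] -/
private theorem dist_cross_le {t : Fin 2 → E3} {A : E3 →L[ℝ] E3} (hA : Adm₀ A) (hI : Inner₀ t A) (ζ : E3) :
    dist (t 0 + A ζ) (t 1 + A ζ) ≤ 11 / 10 := by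
  rw [dist_eq_norm, add_sub_add_right_eq_sub, norm_sub_rev]
  linarith [norm_inner_shift_le hA hI]

/-- The bond `t 1 + Aζ ∼ t 0 + A(ζ + c)` has length `≤ 11/10`. [folklore] -/
private theorem dist_cross'_le {t : Fin 2 → E3} {A : E3 →L[ℝ] E3} (hA : Adm₀ A) (hI : Inner₀ t A) (ζ : E3) :
    dist (t 1 + A ζ) (t 0 + A (ζ + layerNormal (2 * Real.sqrt (2 / 3)))) ≤ 11 / 10 := by
  have h1 : ‖A (layerNormal (2 * Real.sqrt (2 / 3)) -
      (barlowOffset 1 + layerNormal (Real.sqrt (2 / 3))))‖ ≤ 199 / 200 := by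
    have := norm_apply_le_of_adm₀ hA
      (layerNormal (2 * Real.sqrt (2 / 3)) - (barlowOffset 1 + layerNormal (Real.sqrt (2 / 3))))
    rwa [norm_layerPeriod_sub_motif_eq_one, mul_one] at this
  have h2 : ‖t 1 - t 0 - A (barlowOffset 1 + layerNormal (Real.sqrt (2 / 3)))‖ ≤ 1 / 40 := hI
  have hsplit : t 1 + A ζ - (t 0 + A (ζ + layerNormal (2 * Real.sqrt (2 / 3)))) =
      (t 1 - t 0 - A (barlowOffset 1 + layerNormal (Real.sqrt (2 / 3)))) -
        A (layerNormal (2 * Real.sqrt (2 / 3)) - (barlowOffset 1 + layerNormal (Real.sqrt (2 / 3)))) := by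
    rw [map_add, map_sub]; abel
  rw [dist_eq_norm, hsplit]
  have h3 := norm_sub_le (t 1 - t 0 - A (barlowOffset 1 + layerNormal (Real.sqrt (2 / 3))))
    (A (layerNormal (2 * Real.sqrt (2 / 3)) - (barlowOffset 1 + layerNormal (Real.sqrt (2 / 3)))))
  linarith

/-! ## Archimedes along a ray of sites -/

/-- **A shift-invariant period difference vanishes**: if `e ∈ Λ₀` and the period difference
`w = u(· + Ae) − u` satisfies `w(p + Ae) = w(p)` on the sites, then `u(p + nAe) = u(p) + n·w(p)` along
the ray of sites `p + ℕ·Ae`, so the bound `‖u‖ ≤ 1/40` on the sites forces `w = 0`. [folklore] -/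
private theorem periodic_of_shift_invariant {t : Fin 2 → E3} {A : E3 →L[ℝ] E3} {u : E3 → E3} {e : E3}
    (hD : ∀ s ∈ Sites₀ t A, ‖u s‖ ≤ 1 / 40) (he : e ∈ Λ₀)
    (hw : ∀ p ∈ Sites₀ t A, u (p + A e + A e) - u (p + A e) = u (p + A e) - u p) :
    ∀ p ∈ Sites₀ t A, u (p + A e) = u p := by
  intro p hp
  set c := u (p + A e) - u p with hc
  have hsucc : ∀ n : ℕ, p + ((n + 1 : ℕ) : ℝ) • A e = p + (n : ℝ) • A e + A e := by
    intro n
    push_cast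
    rw [add_smul, one_smul, add_assoc]
  -- the points of the ray are sites
  have hmem : ∀ n : ℕ, p + (n : ℝ) • A e ∈ Sites₀ t A := by
    intro n
    induction n with
    | zero => simpa using hp
    | succ n ih => rw [hsucc]; exact add_apply_mem_sites₀ ih he
  -- the period difference is constant along the ray
  have hdiff : ∀ n : ℕ, u (p + (n : ℝ) • A e + A e) - u (p + (n : ℝ) • A e) = c := by
    intro n
    induction n with
    | zero => simp [hc]
    | succ n ih => rw [hsucc, hw _ (hmem n), ih]
  -- hence `u` is affine along the ray
  have hlin : ∀ n : ℕ, u (p + (n : ℝ) • A e) = u p + (n : ℝ) • c := by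
    intro n
    induction n with
    | zero => simp
    | succ n ih =>
      have h : u (p + (n : ℝ) • A e + A e) = u (p + (n : ℝ) • A e) + c := by
        rw [← hdiff n]; abel
      rw [hsucc, h, ih]
      push_cast
      rw [add_smul, one_smul, add_assoc]
  -- boundedness of `u` on the sites: `n‖c‖ ≤ 1/20` for every `n`
  have hbd : ∀ n : ℕ, (n : ℝ) * ‖c‖ ≤ 1 / 20 := by
    intro n
    have h1 := hD _ (hmem n)
    have h2 := hD p hp
    rw [hlin n] at h1
    have h3 : ‖(n : ℝ) • c‖ ≤ ‖u p + (n : ℝ) • c‖ + ‖u p‖ := by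
      have := norm_sub_le (u p + (n : ℝ) • c) (u p)
      rwa [add_sub_cancel_left] at this
    rw [norm_smul, Real.norm_natCast] at h3
    linarith
  -- Archimedes
  have hc0 : c = 0 := by
    by_contra hne
    have hpos : 0 < ‖c‖ := norm_pos_iff.2 hne
    obtain ⟨n, hn⟩ := exists_nat_gt (1 / ‖c‖)
    have h := hbd n
    have h' : 1 / ‖c‖ * ‖c‖ = 1 := by field_simp
    nlinarith [mul_lt_mul_of_pos_right hn hpos]
  rw [hc] at hc0
  exact sub_eq_zero.1 hc0

/-! ## The three generators are periods -/

/-- For a generator `e ∈ Λ₀` with `‖e‖ = 1` the bond `p ∼ p + Ae` is a nearest-neighbour bond, so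
flatness gives shift invariance of `u(· + Ae) − u` directly. [folklore] -/
private theorem shift_invariant_of_norm_eq_one {t : Fin 2 → E3} {A : E3 →L[ℝ] E3} {u : E3 → E3} {e : E3}
    (hA : Adm₀ A) (hF : NNFlat t A u) (he : e ∈ Λ₀) (hne : ‖e‖ = 1) :
    ∀ p ∈ Sites₀ t A, u (p + A e + A e) - u (p + A e) = u (p + A e) - u p := by
  intro p hp
  have hd : dist (p + A e) p ≤ 11 / 10 := by
    rw [dist_eq_norm, add_sub_cancel_left]
    have := norm_apply_le_of_adm₀ hA e
    rw [hne, mul_one] at this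
    linarith
  exact hF e he (p + A e) (add_apply_mem_sites₀ hp he) p hp hd

/-- For the layer period `c` one reaches `p + Ac` from `p` through the other sublattice along two
nearest-neighbour bonds, so flatness again gives shift invariance of `u(· + Ac) − u`. [folklore] -/
private theorem shift_invariant_layerPeriod {t : Fin 2 → E3} {A : E3 →L[ℝ] E3} {u : E3 → E3}
    (hA : Adm₀ A) (hI : Inner₀ t A) (hF : NNFlat t A u) :
    ∀ p ∈ Sites₀ t A,
      u (p + A (layerNormal (2 * Real.sqrt (2 / 3))) + A (layerNormal (2 * Real.sqrt (2 / 3)))) -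
          u (p + A (layerNormal (2 * Real.sqrt (2 / 3)))) =
        u (p + A (layerNormal (2 * Real.sqrt (2 / 3)))) - u p := by
  set c : E3 := layerNormal (2 * Real.sqrt (2 / 3)) with hcdef
  have hc : c ∈ Λ₀ := layerPeriod_mem_Λ₀
  -- bond 1: `w (t 0 + A ξ) = w (t 1 + A ξ)`
  have b1 : ∀ ξ ∈ Λ₀, u (t 0 + A ξ + A c) - u (t 0 + A ξ) = u (t 1 + A ξ + A c) - u (t 1 + A ξ) :=
    fun ξ hξ => hF c hc _ ⟨0, ξ, hξ, rfl⟩ _ ⟨1, ξ, hξ, rfl⟩ (dist_cross_le hA hI ξ)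
  -- bond 2: `w (t 1 + A ξ) = w (t 0 + A (ξ + c))`
  have b2 : ∀ ξ ∈ Λ₀, u (t 1 + A ξ + A c) - u (t 1 + A ξ) =
      u (t 0 + A (ξ + c) + A c) - u (t 0 + A (ξ + c)) :=
    fun ξ hξ => hF c hc _ ⟨1, ξ, hξ, rfl⟩ _ ⟨0, ξ + c, hcpLiouvilleLam_add_mem hξ hc, rfl⟩
      (dist_cross'_le hA hI ξ)
  intro p hp
  obtain ⟨m, ζ, hζ, rfl⟩ := hp
  have e1 : t m + A ζ + A c = t m + A (ζ + c) := by rw [map_add, add_assoc]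
  fin_cases m
  · simp only [Fin.zero_eta] at e1 ⊢
    rw [b1 ζ hζ, b2 ζ hζ, e1]
  · simp only [Fin.mk_one] at e1 ⊢
    rw [b2 ζ hζ, b1 (ζ + c) (hcpLiouvilleLam_add_mem hζ hc), e1]

/-! ## Flat and bounded displacements are `AΛ₀`-periodic -/

/-- **Flat + bounded ⇒ periodic**: under `Adm₀`, `Inner₀`, a displacement with flat period differences
is `AΛ₀`-periodic on the sites. [folklore] -/
theorem periodic_of_nnFlat {X : Set E3} {t : Fin 2 → E3} {A : E3 →L[ℝ] E3} {u : E3 → E3}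
    (hA : Adm₀ A) (hI : Inner₀ t A) (hD : IsDisplacement X t A u) (hF : NNFlat t A u) :
    ∀ z ∈ Λ₀, ∀ p ∈ Sites₀ t A, u (p + A z) = u p := by
  have hD1 : ∀ s ∈ Sites₀ t A, ‖u s‖ ≤ 1 / 40 := hD.1
  -- the three generators are periods
  have hu : ∀ p ∈ Sites₀ t A, u (p + A (triangularVec₁ 1)) = u p :=
    periodic_of_shift_invariant hD1 triangularVec₁_mem_Λ₀
      (shift_invariant_of_norm_eq_one hA hF triangularVec₁_mem_Λ₀ norm_triangularVec₁)
  have hv : ∀ p ∈ Sites₀ t A, u (p + A (triangularVec₂ 1)) = u p :=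
    periodic_of_shift_invariant hD1 triangularVec₂_mem_Λ₀
      (shift_invariant_of_norm_eq_one hA hF triangularVec₂_mem_Λ₀ norm_triangularVec₂_eq_one)
  have hc : ∀ p ∈ Sites₀ t A, u (p + A (layerNormal (2 * Real.sqrt (2 / 3)))) = u p :=
    periodic_of_shift_invariant hD1 layerPeriod_mem_Λ₀ (shift_invariant_layerPeriod hA hI hF)
  -- the lattice periods form a subgroup
  let G : AddSubgroup E3 :=
    { carrier := {z | z ∈ Λ₀ ∧ ∀ p ∈ Sites₀ t A, u (p + A z) = u p}
      add_mem' := by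
        rintro a b ⟨ha, ha'⟩ ⟨hb, hb'⟩
        refine ⟨hcpLiouvilleLam_add_mem ha hb, fun p hp => ?_⟩
        rw [map_add, ← add_assoc, hb' _ (add_apply_mem_sites₀ hp ha), ha' p hp]
      zero_mem' := ⟨zero_mem_Λ₀, fun p _ => by rw [map_zero, add_zero]⟩
      neg_mem' := by
        rintro a ⟨ha, ha'⟩
        have hneg : (0 : E3) - a ∈ Λ₀ := hcpLiouvilleLam_sub_mem zero_mem_Λ₀ ha
        rw [zero_sub] at hneg
        refine ⟨hneg, fun p hp => ?_⟩
        have hq : p + A (-a) ∈ Sites₀ t A := by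
          rw [map_neg, ← sub_eq_add_neg]; exact sub_apply_mem_sites₀ hp ha
        have h := ha' _ hq
        rw [map_neg, neg_add_cancel_right] at h
        rw [map_neg]
        exact h.symm }
  have h1 : (triangularVec₁ 1 : E3) ∈ G := ⟨triangularVec₁_mem_Λ₀, hu⟩
  have h2 : (triangularVec₂ 1 : E3) ∈ G := ⟨triangularVec₂_mem_Λ₀, hv⟩
  have h3 : (layerNormal (2 * Real.sqrt (2 / 3)) : E3) ∈ G := ⟨layerPeriod_mem_Λ₀, hc⟩
  intro z hz
  have hzG : z ∈ G := by
    obtain ⟨i, j, k, rfl⟩ := hz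
    rw [Int.cast_smul_eq_zsmul ℝ i, Int.cast_smul_eq_zsmul ℝ j, Int.cast_smul_eq_zsmul ℝ k]
    exact G.add_mem (G.add_mem (G.zsmul_mem h1 i) (G.zsmul_mem h2 j)) (G.zsmul_mem h3 k)
  exact hzG.2

/-! ## The stub -/

/-- **Stub `stub_sites_of_flat` (line `Sketch`, crux `HcpLiouville`)**: a bounded displacement of the
reference two-lattice with flat period differences is `AΛ₀`-periodic, so the displaced configuration is
again a two-lattice with the same cell, `X = Sites₀ t' A` with `t' m = t m + u (t m)`. [folklore] -/
theorem stub_sites_of_flat : ∀ (X : Set E3) (t : Fin 2 → E3) (A : E3 →L[ℝ] E3) (u : E3 → E3), Adm₀ A → Inner₀ t A → IsDisplacement X t A u → NNFlat t A u → ∃ t' : Fin 2 → E3, X = Sites₀ t' A := by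
  intro X t A u hA hI hD hF
  have hper := periodic_of_nnFlat hA hI hD hF
  refine ⟨fun m => t m + u (t m), ?_⟩
  rw [← hD.2.image_eq]
  ext x
  constructor
  · rintro ⟨s, ⟨m, z, hz, rfl⟩, rfl⟩
    refine ⟨m, z, hz, ?_⟩
    have h := hper z hz (t m) (apply_mem_sites₀ t A m)
    show t m + A z + u (t m + A z) = t m + u (t m) + A z
    rw [h]; abel
  · rintro ⟨m, z, hz, rfl⟩
    refine ⟨t m + A z, ⟨m, z, hz, rfl⟩, ?_⟩
    have h := hper z hz (t m) (apply_mem_sites₀ t A m)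
    show t m + A z + u (t m + A z) = t m + u (t m) + A z
    rw [h]; abel

end Summit.AtomisticToContinuum.Crystallization.Theorems.ExcessDecayLiouville

end
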